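import Summits.BirchSwinnertonDyer.BirchSwinnertonDyer.Theorems.CumulativeHeegnerLeopoldtCumulativeHeegnerInclusionAtThreeResidualDevissage
import Summits.BirchSwinnertonDyer.Rank1Residual.X11b.AnticyclotomicLocalTowerTorsion
import HarnessLib

/-!
# Route `PrintCFram`, crux C2 `BottomClassIndexLawFiveLe` (stmt-BirchSwinnertonDyer-20372), line `eisenstein-resource-bdp-line`:
# the LOCAL hypothesis of the algebraic half (ALG′) of stub 2′ descends to the bottom layer —
# «`(E[p]/Φ)^{G_{K_{∞,𝔭}}} = 0` ⟺ `(E[p]/Φ)^{D_𝔭} = 0`» by pro-`p` descent along the `ℤ_p`-extension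
# (cell `bsd-print-cfram`, width seat `bsd-line-cfram-p1-w2` g3; helper `--supports` 20372; THEOREMS ONLY, 0 facts, 0 definitions)

HONEST FRAMING. Nothing about BSD is proved; no stub is closed. LEAD g3's reduction of the registered
`stub_invariantMatch_cmRamified` (`…EisensteinAlgebraicMu(Refined).lean`, p621566) asks at every frame for a `Γ_{K''}`-stable line
`Φ ≤ W[p]` with **`(W[p]/Φ)^{G_{K''_{∞,𝔭′}}} = 0`**, in the currency
`∀ y : Φ.Quot, (∀ g : ↥(κ.kerSubgroup ⊓ decomp 𝔭′), g • y = y) → y = 0` of the CHL devissage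
(`finite_selmerAc_empty_pTorsion_of_line_devissage`). This file proves, for ANY elliptic curve over ANY number field, ANY
`ℤ_p`-extension `κ`, ANY place `𝔭` and ANY stable subgroup `Φ ≤ E[p]`:

* `quot_eq_zero_of_fixed_kerSubgroup_inf_decomp` / `quot_fixed_kerSubgroup_inf_decomp_iff` — that hypothesis is EQUIVALENT to
  the bottom-layer statement `(E[p]/Φ)^{D_𝔭} = 0` («no non-zero `D_𝔭`-fixed vector in the quotient»): the tower disappears.
  Proof: the tree's generic pro-`p` descent `AcSelmer.eq_zero_of_fixed_inf_kerSubgroup` (a pro-`p` group — `D_𝔭/(D_𝔭 ∩ ker κ) ↪ ℤ_p`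
  — acting on a non-zero finite `p`-group has a non-zero fixed point) applied to the finite discrete `p`-torsion module `E[p]/Φ`.
* `quot_fixed_decomp_eq_zero_of_exists_smul_ne` — when `E[p]/Φ` has prime order `p` (a LINE), it suffices to exhibit ONE
  `d ∈ D_𝔭` moving ONE vector of the quotient (the quotient character is non-trivial on `D_𝔭`).

So on the CM-ramified rows of C2 (`K''_{𝔭′} = ℚ_p`, `Φ = W[𝔭]`, quotient character `χ_d·ω^{(3p−1)/4}` or `χ_d·ω^{(p+1)/4}` on
inertia at `p`, of order `≥ 3` — w2 g2's trace-form theorems p617940/p618935) the local input of (ALG′) is the statement that this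
character is non-trivial on `D_p`, at the BOTTOM layer only. Constructing `Φ = W[𝔭]_{K''}` as a `StableSubgroup` with that quotient
action is NOT done here. BSD is not proved by any of this; no summit statement is proved by this seat.

References: Greenberg, LNM 1716 (1999) §3 Lemma 3.1 [GreenbergLNM1716]; Serre, *Local Fields* IX §1 [SerreLocalFields1979];
Castella–Grossi–Lee–Skinner, Invent. Math. 227 (2022) §3 Prop. 3.2.1 [CastellaGrossiLeeSkinner2022].
-/

noncomputable section

open scoped Classical

set_option linter.dupNamespace false
set_option autoImplicit false

namespace Summit.BirchSwinnertonDyer.BirchSwinnertonDyer.Theorems.PrintCFram.EisensteinLocalLineDescent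

open NumberField IsDedekindDomain Field
  Literature.NumberTheory.EllipticCurves Literature.NumberTheory.EllipticCurves.GreenbergSelmer
  Literature.NumberTheory.GaloisRepresentations
  Summit.BirchSwinnertonDyer.Rank1Residual.X11b.AcSelmer
  Summit.BirchSwinnertonDyer.Rank1Residual.X2.ResidualDevissageModules
  Summit.BirchSwinnertonDyer.BirchSwinnertonDyer.Theorems.CumulativeHeegnerInclusionAtThreeResidualDevissage

variable {K : Type} [Field K] [NumberField K] (W : WeierstrassCurve K) [W.IsElliptic] {p : ℕ} [Fact p.Prime]
  (κ : ZpExtension K p) (𝔭 : HeightOneSpectrum (𝓞 K))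
  (Φ : StableSubgroup (absoluteGaloisGroup K) (W.geomTorsion (p : ℤ)))

omit [NumberField K] in
/-- The quotient `E[p]/Φ` of the (finite) `p`-torsion by a stable subgroup is finite. [cite: SilvermanAEC2009, Cor. III.6.4] -/
theorem finite_quot : Finite Φ.Quot := by
  haveI : Finite (W.geomTorsion (p : ℤ)) :=
    W.finite_torsionPoints_holds (AlgebraicClosure K) (by exact_mod_cast (Fact.out : p.Prime).ne_zero)
  exact Finite.of_surjective Φ.proj Φ.proj_surjective

omit [NumberField K] [W.IsElliptic] [Fact p.Prime] in
/-- `p` kills the quotient `E[p]/Φ`. [folklore] -/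
theorem prime_smul_quot_eq_zero (y : Φ.Quot) : p • y = 0 :=
  Φ.nsmul_quot_eq_zero (fun m => AddSubgroup.torsionBy.nsmul m) y

/-- **Pro-`p` descent for the quotient: `(E[p]/Φ)^{D_𝔭} = 0 ⟹ (E[p]/Φ)^{D_𝔭 ∩ ker κ} = 0`.** If no non-zero vector of `E[p]/Φ`
is fixed by the decomposition group `D_𝔭 = decomp 𝔭`, then no non-zero vector is fixed by `ker κ ⊓ D_𝔭`, the decomposition group of
`K_∞ = K̄^{ker κ}` at the place above `𝔭` of the chosen embedding — the hypothesis `hfix` of the line devissage, for every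
`ℤ_p`-extension `κ`. (Generic pro-`p` descent `AcSelmer.eq_zero_of_fixed_inf_kerSubgroup` on the finite discrete `p`-torsion
`Γ_K`-module `E[p]/Φ`.) [cite: GreenbergLNM1716, §3 Lemma 3.1 (p. 86)] [cite: SerreLocalFields1979, IX.§1] -/
theorem quot_eq_zero_of_fixed_kerSubgroup_inf_decomp
    (hD : ∀ y : Φ.Quot, (∀ d ∈ decomp 𝔭, d • y = y) → y = 0)
    (y : Φ.Quot) (hy : ∀ g : ↥(κ.kerSubgroup ⊓ decomp 𝔭), g • y = y) : y = 0 := by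
  haveI : Finite Φ.Quot := finite_quot W Φ
  refine eq_zero_of_fixed_inf_kerSubgroup κ (decomp 𝔭) (isClosed_decomp 𝔭)
    (fun z => Φ.continuous_smul_quot (continuous_smul_geomTorsion W (p : ℤ)) z)
    (fun z => ⟨1, by rw [pow_one]; exact prime_smul_quot_eq_zero W Φ z⟩)
    (fun _ => Set.toFinite _)
    (fun z hz _ => hD z hz) ?_
  intro g hg
  obtain ⟨hgD, hgker⟩ := Subgroup.mem_inf.mp hg
  have := hy ⟨g, Subgroup.mem_inf.mpr ⟨hgker, hgD⟩⟩
  simpa only [Subgroup.mk_smul] using this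

/-- **The local devissage hypothesis ⟺ its bottom layer: `(E[p]/Φ)^{G_{K_{∞,𝔭}}} = 0 ↔ (E[p]/Φ)^{D_𝔭} = 0`** (any curve, number
field, `ℤ_p`-extension, place, stable subgroup). The forward direction is restriction to the subgroup; the backward one is
`quot_eq_zero_of_fixed_kerSubgroup_inf_decomp`. [cite: GreenbergLNM1716, §3 Lemma 3.1 (p. 86)] -/
theorem quot_fixed_kerSubgroup_inf_decomp_iff :
    (∀ y : Φ.Quot, (∀ g : ↥(κ.kerSubgroup ⊓ decomp 𝔭), g • y = y) → y = 0) ↔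
      (∀ y : Φ.Quot, (∀ d ∈ decomp 𝔭, d • y = y) → y = 0) := by
  constructor
  · intro h y hy
    exact h y fun g => by
      rw [Subgroup.smul_def]
      exact hy g (Subgroup.mem_inf.mp g.2).2
  · intro hD y hy
    exact quot_eq_zero_of_fixed_kerSubgroup_inf_decomp W κ 𝔭 Φ hD y hy

omit [W.IsElliptic] in
/-- **For a LINE it suffices to move one vector.** If `E[p]/Φ` has prime order `p` and some `d ∈ D_𝔭` moves some vector of it, then
`(E[p]/Φ)^{D_𝔭} = 0`: a non-zero fixed vector would generate the quotient (prime order), on which `d` would then act trivially.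
(The quotient CHARACTER is non-trivial on `D_𝔭`.) [cite: GreenbergVatsal2000, §2 p. 28 (the characters of Φ and E[p]/Φ)] -/
theorem quot_fixed_decomp_eq_zero_of_exists_smul_ne (hcard : Nat.card Φ.Quot = p)
    {d : absoluteGaloisGroup K} (hd : d ∈ decomp 𝔭) (hne : ∃ z : Φ.Quot, d • z ≠ z) :
    ∀ y : Φ.Quot, (∀ d ∈ decomp 𝔭, d • y = y) → y = 0 := by
  intro y hy
  by_contra hy0
  obtain ⟨z, hz⟩ := hne
  have hzmem : z ∈ AddSubgroup.zmultiples y := mem_zmultiples_of_prime_card hcard hy0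
  obtain ⟨n, rfl⟩ := AddSubgroup.mem_zmultiples_iff.mp hzmem
  apply hz
  rw [smul_comm d n y, hy d hd]

/-- **The devissage's local hypothesis for a LINE, from one moving element at the bottom layer** (composition of the two previous
theorems): for every `ℤ_p`-extension `κ`, if `E[p]/Φ` has order `p` and some `d ∈ D_𝔭` moves some vector, then
`∀ y : E[p]/Φ, (∀ g ∈ ker κ ⊓ D_𝔭, g • y = y) → y = 0`. [cite: GreenbergLNM1716, §3 Lemma 3.1 (p. 86)] -/
theorem quot_eq_zero_of_fixed_kerSubgroup_inf_decomp_of_exists_smul_ne (hcard : Nat.card Φ.Quot = p)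
    {d : absoluteGaloisGroup K} (hd : d ∈ decomp 𝔭) (hne : ∃ z : Φ.Quot, d • z ≠ z) :
    ∀ y : Φ.Quot, (∀ g : ↥(κ.kerSubgroup ⊓ decomp 𝔭), g • y = y) → y = 0 :=
  (quot_fixed_kerSubgroup_inf_decomp_iff W κ 𝔭 Φ).mpr
    (quot_fixed_decomp_eq_zero_of_exists_smul_ne W 𝔭 Φ hcard hd hne)

end Summit.BirchSwinnertonDyer.BirchSwinnertonDyer.Theorems.PrintCFram.EisensteinLocalLineDescent

end
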